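import Mathlib
import Summits.ValiantsHypothesis.ValiantsHypothesis.Theorems.LacunarySymmetroidMatrixDescartesGramDualCoherent
import Summits.ValiantsHypothesis.ValiantsHypothesis.Theorems.LacunarySymmetroidMatrixDescartesGramDualRank

/-!
# `MatrixDescartes` (stmt-ValiantsHypothesis-18050) — THE QUASI-DEFINITE CONE: lacunary pencils all of whose letters are
# positive semidefinite on one fixed subspace and negative semidefinite on a fixed complement — off-diagonal blocks
# ARBITRARY — have no positive zero, at every size, for every number of letters and all exponents

HONEST FRAMING.  Cell `pub-symmetroid`, seat `val-sym-mdr-p2` (gen 20); helper file `--supports` the crux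
`Theses.LacunarySymmetroid.MatrixDescartes` (OPEN), NO closure claim; primal companion of `…GramDualCoherent` (the
sign-coherent Gram law, which is the same mechanism on the dual side).  A STERILE-SECTOR law; nothing here bears on the
crux in its window, `stub_twoSided`, `DoorA26` / `DoorA34`, registers, or `VP ≠ VNP`.

THE CONE.  Fix a splitting of the coordinates (after a constant congruence: of `ℝ^m`) into a «positive» part `P` and a
«negative» part `N`.  A real symmetric matrix is QUASI-SEMIDEFINITE for the splitting if it is `⪰ 0` on vectors supported
on `P` and `⪯ 0` on vectors supported on `N` — in block form `[[A, X], [Xᵀ, −D]]` with `A, D ⪰ 0` and `X` ARBITRARY.  These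
matrices form a convex cone containing genuinely indefinite, pairwise non-commuting matrices; a pencil
`F = Σ_l X^{d_l} S_l` with all letters in the cone stays in the cone at every `x > 0`.

* `det_ne_zero_of_quasiDefinite` — a symmetric matrix that is positive DEFINITE on the `P`-supported vectors and negative
  definite on the `N`-supported ones is non-degenerate (`v' = (v_P, −v_N)`: `v'ᵀMv = v_PᵀMv_P − v_NᵀMv_N > 0`, the cross
  terms cancel by symmetry).
* **`quasiDefinite_pencil_posRoots_eq_empty` (THE QUASI-DEFINITE CONE LAW).**  All letters quasi-semidefinite for one
  splitting, and the family STRICT on each side (every non-zero `P`-supported `v` has `vᵀS_lv > 0` for SOME letter, i.e.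
  `Σ_l S_l ≻ 0` on the `P`-block; likewise `< 0` on the `N`-block) ⇒ `det F` has NO positive zero — every size `m`, every
  `K`, all exponents (both sides, ties), any index type.  The positive cone (`N = ∅`: all letters PSD, jointly definite) is
  the trivial case; the content is the indefinite cone, e.g. (`m = 2`, splitting `(1,1)`) letters `[[p_l, x_l],[x_l, −n_l]]`,
  `det F = −(Σp_lx^{d_l})(Σn_lx^{d_l}) − (Σx_lx^{d_l})² < 0`.
* `posRoots_pencil_congr` — a constant congruence `S_l ↦ TᵀS_lT` (`det T ≠ 0`) keeps the positive zeros, so the splitting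
  may be any pair of complementary subspaces (`quasiDefinite_pencil_posRoots_eq_empty_congr`).
* `fromBlocks_pencil_posRoots_eq_empty` — block form: letters `fromBlocks (A l) (X l) (X l)ᵀ (−D l)` with `A l, D l ⪰ 0`,
  `Σ A l ≻ 0`, `Σ D l ≻ 0`, `X l` arbitrary ⇒ no positive zero.
Without strictness the law fails only by degeneration (`[[0, x_l],[x_l, −n_l]]`: `det F = −(Σx_lx^{d_l})²`, double zeros).
«Dead-end sterilisation» by SIGN STRUCTURE: a uniformly quasi-definite pencil has constant inertia `(|P|, |N|)`.

[folklore] (quasi-definite matrices are non-singular).  Axioms `propext`, `Classical.choice`, `Quot.sound`.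
-/

-- layout Summits/ValiantsHypothesis/ValiantsHypothesis forces the duplicated namespace component
set_option linter.dupNamespace false

namespace Summit.ValiantsHypothesis.ValiantsHypothesis.Theorems.LacunarySymmetroidMatrixDescartes

open Polynomial Matrix Finset
open scoped BigOperators

namespace QuasiDefinite

variable {ι : Type} [Fintype ι] [DecidableEq ι]

/-! ## §1  Quasi-definite symmetric matrices are non-degenerate -/

/-- **Quasi-definite ⇒ non-degenerate.**  `M` real symmetric, `P` a set of coordinates; if `vᵀMv > 0` for every non-zero `v`
supported on `P` and `vᵀMv < 0` for every non-zero `v` supported off `P`, then `det M ≠ 0`. [folklore] -/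
theorem det_ne_zero_of_quasiDefinite (M : Matrix ι ι ℝ) (hM : M.IsSymm) (P : ι → Prop) [DecidablePred P]
    (hP : ∀ v : ι → ℝ, (∀ i, ¬ P i → v i = 0) → v ≠ 0 → 0 < v ⬝ᵥ (M *ᵥ v))
    (hN : ∀ v : ι → ℝ, (∀ i, P i → v i = 0) → v ≠ 0 → v ⬝ᵥ (M *ᵥ v) < 0) :
    M.det ≠ 0 := by
  intro hdet
  obtain ⟨v, hv0, hMv⟩ := Matrix.exists_mulVec_eq_zero_iff.2 hdet
  set vP : ι → ℝ := fun i => if P i then v i else 0 with hvP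
  set vN : ι → ℝ := fun i => if P i then 0 else v i with hvN
  have hsum : v = vP + vN := by
    funext i
    simp only [hvP, hvN, Pi.add_apply]
    split_ifs <;> simp
  have hPN : vP ⬝ᵥ (M *ᵥ vN) = vN ⬝ᵥ (M *ᵥ vP) := GramDual.dotProduct_mulVec_comm_of_isSymm hM vP vN
  have hpair : (vP - vN) ⬝ᵥ (M *ᵥ v) = vP ⬝ᵥ (M *ᵥ vP) - vN ⬝ᵥ (M *ᵥ vN) := by
    rw [hsum, Matrix.mulVec_add, sub_dotProduct, dotProduct_add, dotProduct_add, hPN]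
    ring
  have htot : (vP - vN) ⬝ᵥ (M *ᵥ v) = 0 := by rw [hMv, dotProduct_zero]
  have hsuppP : ∀ i, ¬ P i → vP i = 0 := fun i hi => by simp only [hvP]; rw [if_neg hi]
  have hsuppN : ∀ i, P i → vN i = 0 := fun i hi => by simp only [hvN]; rw [if_pos hi]
  -- both halves vanish
  have hP0 : vP = 0 := by
    by_contra h
    have h1 := hP vP hsuppP h
    have h2 : vN ⬝ᵥ (M *ᵥ vN) ≤ 0 := by
      by_cases hn : vN = 0
      · rw [hn, Matrix.mulVec_zero, dotProduct_zero]
      · exact (hN vN hsuppN hn).le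
    rw [hpair] at htot
    linarith
  have hN0 : vN = 0 := by
    by_contra h
    have h1 := hN vN hsuppN h
    rw [hpair, hP0, Matrix.mulVec_zero, dotProduct_zero, zero_sub, neg_eq_zero] at htot
    exact h1.ne htot
  exact hv0 (by rw [hsum, hP0, hN0, add_zero])

/-! ## §2  The quasi-definite cone law for lacunary pencils -/

section Pencil

variable {K : ℕ}

/-- Evaluating a pencil: `(Σ_l X^{d_l} S_l)(x) = Σ_l x^{d_l} S_l`. [folklore] -/
theorem eval_pencil (d : Fin K → ℕ) (S : Fin K → Matrix ι ι ℝ) (x : ℝ) :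
    (Polynomial.evalRingHom x).mapMatrix (∑ l, ((Polynomial.X : Polynomial ℝ) ^ d l) • (S l).map Polynomial.C)
      = ∑ l, x ^ d l • S l := by
  ext i j
  simp only [RingHom.mapMatrix_apply, Matrix.map_apply, Matrix.sum_apply, Matrix.smul_apply, smul_eq_mul,
    Polynomial.coe_evalRingHom, Polynomial.eval_finsetSum, Polynomial.eval_mul, Polynomial.eval_pow,
    Polynomial.eval_X, Polynomial.eval_C]

/-- `det` of a pencil, evaluated. [folklore] -/
theorem eval_det_pencil (d : Fin K → ℕ) (S : Fin K → Matrix ι ι ℝ) (x : ℝ) :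
    (Matrix.det (∑ l, ((Polynomial.X : Polynomial ℝ) ^ d l) • (S l).map Polynomial.C)).eval x
      = (∑ l, x ^ d l • S l).det := by
  have h := RingHom.map_det (Polynomial.evalRingHom x) (∑ l, ((Polynomial.X : Polynomial ℝ) ^ d l) • (S l).map Polynomial.C)
  rw [Polynomial.coe_evalRingHom] at h
  rw [h, eval_pencil]

omit [DecidableEq ι] in
/-- The quadratic form of an evaluated pencil: `vᵀ(Σ x^{d_l}S_l)v = Σ x^{d_l}·vᵀS_lv`. [folklore] -/
theorem form_pencil (d : Fin K → ℕ) (S : Fin K → Matrix ι ι ℝ) (x : ℝ) (v : ι → ℝ) :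
    v ⬝ᵥ ((∑ l, x ^ d l • S l) *ᵥ v) = ∑ l, x ^ d l * (v ⬝ᵥ (S l *ᵥ v)) := by
  rw [Matrix.sum_mulVec, dotProduct_sum]
  refine Finset.sum_congr rfl fun l _ => ?_
  rw [Matrix.smul_mulVec, dotProduct_smul, smul_eq_mul]

omit [Fintype ι] [DecidableEq ι] in
/-- A pencil of symmetric letters is symmetric at every scale. [folklore] -/
theorem isSymm_eval_pencil (d : Fin K → ℕ) (S : Fin K → Matrix ι ι ℝ) (hS : ∀ l, (S l).IsSymm) (x : ℝ) :
    (∑ l, x ^ d l • S l).IsSymm := by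
  unfold Matrix.IsSymm
  rw [Matrix.transpose_sum]
  exact Finset.sum_congr rfl fun l _ => by rw [Matrix.transpose_smul, (hS l).eq]

/-- **A quasi-definite pencil is non-degenerate at every positive scale.** [folklore] -/
theorem det_eval_pencil_ne_zero_of_quasiDefinite (d : Fin K → ℕ) (S : Fin K → Matrix ι ι ℝ)
    (hS : ∀ l, (S l).IsSymm) (P : ι → Prop) [DecidablePred P]
    (hP : ∀ l (v : ι → ℝ), (∀ i, ¬ P i → v i = 0) → 0 ≤ v ⬝ᵥ (S l *ᵥ v))
    (hN : ∀ l (v : ι → ℝ), (∀ i, P i → v i = 0) → v ⬝ᵥ (S l *ᵥ v) ≤ 0)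
    (hP' : ∀ v : ι → ℝ, (∀ i, ¬ P i → v i = 0) → v ≠ 0 → ∃ l, 0 < v ⬝ᵥ (S l *ᵥ v))
    (hN' : ∀ v : ι → ℝ, (∀ i, P i → v i = 0) → v ≠ 0 → ∃ l, v ⬝ᵥ (S l *ᵥ v) < 0)
    {x : ℝ} (hx : 0 < x) :
    (∑ l, x ^ d l • S l).det ≠ 0 := by
  refine det_ne_zero_of_quasiDefinite _ (isSymm_eval_pencil d S hS x) P (fun v hv hv0 => ?_) (fun v hv hv0 => ?_)
  · obtain ⟨l₁, hl₁⟩ := hP' v hv hv0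
    rw [form_pencil]
    calc (0 : ℝ) < x ^ d l₁ * (v ⬝ᵥ (S l₁ *ᵥ v)) := mul_pos (pow_pos hx _) hl₁
      _ ≤ ∑ l, x ^ d l * (v ⬝ᵥ (S l *ᵥ v)) :=
          Finset.single_le_sum (f := fun l => x ^ d l * (v ⬝ᵥ (S l *ᵥ v)))
            (fun l _ => mul_nonneg (pow_pos hx _).le (hP l v hv)) (Finset.mem_univ l₁)
  · obtain ⟨l₁, hl₁⟩ := hN' v hv hv0
    rw [form_pencil]
    have hle : ∀ l ∈ (Finset.univ : Finset (Fin K)), x ^ d l * (v ⬝ᵥ (S l *ᵥ v)) ≤ 0 :=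
      fun l _ => mul_nonpos_of_nonneg_of_nonpos (pow_pos hx _).le (hN l v hv)
    have hlt : x ^ d l₁ * (v ⬝ᵥ (S l₁ *ᵥ v)) < 0 := mul_neg_of_pos_of_neg (pow_pos hx _) hl₁
    calc ∑ l, x ^ d l * (v ⬝ᵥ (S l *ᵥ v))
        = x ^ d l₁ * (v ⬝ᵥ (S l₁ *ᵥ v)) + ∑ l ∈ Finset.univ.erase l₁, x ^ d l * (v ⬝ᵥ (S l *ᵥ v)) :=
          (Finset.add_sum_erase _ _ (Finset.mem_univ l₁)).symm
      _ < 0 + 0 := add_lt_add_of_lt_of_le hlt (Finset.sum_nonpos fun l hl => hle l (Finset.mem_univ l))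
      _ = 0 := add_zero 0

/-- **THE QUASI-DEFINITE CONE LAW.**  Real symmetric letters `S_l`, all `⪰ 0` on the vectors supported on `P` and `⪯ 0` on
the vectors supported off `P`, jointly STRICT on each side; then `det(Σ_l X^{d_l} S_l)` has NO positive zero — for every
size, every number of letters and all exponents. [folklore] -/
theorem quasiDefinite_pencil_posRoots_eq_empty (d : Fin K → ℕ) (S : Fin K → Matrix ι ι ℝ)
    (hS : ∀ l, (S l).IsSymm) (P : ι → Prop) [DecidablePred P]
    (hP : ∀ l (v : ι → ℝ), (∀ i, ¬ P i → v i = 0) → 0 ≤ v ⬝ᵥ (S l *ᵥ v))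
    (hN : ∀ l (v : ι → ℝ), (∀ i, P i → v i = 0) → v ⬝ᵥ (S l *ᵥ v) ≤ 0)
    (hP' : ∀ v : ι → ℝ, (∀ i, ¬ P i → v i = 0) → v ≠ 0 → ∃ l, 0 < v ⬝ᵥ (S l *ᵥ v))
    (hN' : ∀ v : ι → ℝ, (∀ i, P i → v i = 0) → v ≠ 0 → ∃ l, v ⬝ᵥ (S l *ᵥ v) < 0) :
    (Matrix.det (∑ l, ((Polynomial.X : Polynomial ℝ) ^ d l) • (S l).map Polynomial.C)).roots.toFinset.filter
        (fun t => 0 < t) = ∅ := by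
  rw [Finset.filter_eq_empty_iff]
  intro t ht hpos
  rw [Multiset.mem_toFinset, Polynomial.mem_roots', Polynomial.IsRoot.def, eval_det_pencil] at ht
  exact det_eval_pencil_ne_zero_of_quasiDefinite d S hS P hP hN hP' hN' hpos ht.2

/-- Counted form: `Z₊ = 0` on the quasi-definite cone. [folklore] -/
theorem quasiDefinite_pencil_card_posRoots_eq_zero (d : Fin K → ℕ) (S : Fin K → Matrix ι ι ℝ)
    (hS : ∀ l, (S l).IsSymm) (P : ι → Prop) [DecidablePred P]
    (hP : ∀ l (v : ι → ℝ), (∀ i, ¬ P i → v i = 0) → 0 ≤ v ⬝ᵥ (S l *ᵥ v))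
    (hN : ∀ l (v : ι → ℝ), (∀ i, P i → v i = 0) → v ⬝ᵥ (S l *ᵥ v) ≤ 0)
    (hP' : ∀ v : ι → ℝ, (∀ i, ¬ P i → v i = 0) → v ≠ 0 → ∃ l, 0 < v ⬝ᵥ (S l *ᵥ v))
    (hN' : ∀ v : ι → ℝ, (∀ i, P i → v i = 0) → v ≠ 0 → ∃ l, v ⬝ᵥ (S l *ᵥ v) < 0) :
    ((Matrix.det (∑ l, ((Polynomial.X : Polynomial ℝ) ^ d l) • (S l).map Polynomial.C)).roots.toFinset.filter
        (fun t => 0 < t)).card = 0 := by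
  rw [quasiDefinite_pencil_posRoots_eq_empty d S hS P hP hN hP' hN', Finset.card_empty]

/-! ## §3  Constant congruences keep the positive zeros: the splitting may be any pair of complementary subspaces -/

omit [DecidableEq ι] in
/-- Congruence of a pencil by a constant matrix, letter by letter. [folklore] -/
theorem pencil_congr (d : Fin K → ℕ) (S : Fin K → Matrix ι ι ℝ) (T : Matrix ι ι ℝ) :
    (∑ l, ((Polynomial.X : Polynomial ℝ) ^ d l) • (Tᵀ * S l * T).map Polynomial.C)
      = (T.map Polynomial.C)ᵀ * (∑ l, ((Polynomial.X : Polynomial ℝ) ^ d l) • (S l).map Polynomial.C)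
          * T.map Polynomial.C := by
  rw [Finset.mul_sum, Finset.sum_mul]
  refine Finset.sum_congr rfl fun l _ => ?_
  rw [Matrix.map_mul, Matrix.map_mul, Matrix.transpose_map, Matrix.mul_smul, Matrix.smul_mul]

/-- **Congruence invariance of `Z₊`**: `det T ≠ 0` ⇒ the pencils `Σ X^{d_l} S_l` and `Σ X^{d_l} TᵀS_lT` have the same positive
zeros of their determinants. [folklore] -/
theorem posRoots_pencil_congr (d : Fin K → ℕ) (S : Fin K → Matrix ι ι ℝ) (T : Matrix ι ι ℝ) (hT : IsUnit T.det) :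
    (Matrix.det (∑ l, ((Polynomial.X : Polynomial ℝ) ^ d l) • (Tᵀ * S l * T).map Polynomial.C)).roots.toFinset.filter
        (fun t => 0 < t)
      = (Matrix.det (∑ l, ((Polynomial.X : Polynomial ℝ) ^ d l) • (S l).map Polynomial.C)).roots.toFinset.filter
        (fun t => 0 < t) := by
  rw [pencil_congr, Matrix.det_mul, Matrix.det_mul, Matrix.det_transpose]
  have hdetT : (T.map Polynomial.C).det = Polynomial.C T.det := by
    rw [show T.map Polynomial.C = (Polynomial.C : ℝ →+* Polynomial ℝ).mapMatrix T from rfl, ← RingHom.map_det]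
  rw [hdetT]
  have hc : Polynomial.C T.det * Polynomial.C T.det ≠ 0 :=
    mul_ne_zero (Polynomial.C_ne_zero.2 hT.ne_zero) (Polynomial.C_ne_zero.2 hT.ne_zero)
  have hre : Polynomial.C T.det * Matrix.det (∑ l, ((Polynomial.X : Polynomial ℝ) ^ d l) • (S l).map Polynomial.C)
        * Polynomial.C T.det
      = (Polynomial.C T.det * Polynomial.C T.det)
        * Matrix.det (∑ l, ((Polynomial.X : Polynomial ℝ) ^ d l) • (S l).map Polynomial.C) := by ring
  rw [hre]
  by_cases hF : Matrix.det (∑ l, ((Polynomial.X : Polynomial ℝ) ^ d l) • (S l).map Polynomial.C) = 0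
  · rw [hF, mul_zero]
  · rw [Polynomial.roots_mul (mul_ne_zero hc hF), ← Polynomial.C_mul, Polynomial.roots_C, zero_add]

/-- **The cone law for an arbitrary splitting**: if after a constant congruence `S_l ↦ TᵀS_lT` (`det T ≠ 0`) the letters are
quasi-semidefinite and jointly strict for a coordinate splitting, the original pencil has no positive zero. [folklore] -/
theorem quasiDefinite_pencil_posRoots_eq_empty_congr (d : Fin K → ℕ) (S : Fin K → Matrix ι ι ℝ)
    (hS : ∀ l, (S l).IsSymm) (T : Matrix ι ι ℝ) (hT : IsUnit T.det) (P : ι → Prop) [DecidablePred P]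
    (hP : ∀ l (v : ι → ℝ), (∀ i, ¬ P i → v i = 0) → 0 ≤ v ⬝ᵥ ((Tᵀ * S l * T) *ᵥ v))
    (hN : ∀ l (v : ι → ℝ), (∀ i, P i → v i = 0) → v ⬝ᵥ ((Tᵀ * S l * T) *ᵥ v) ≤ 0)
    (hP' : ∀ v : ι → ℝ, (∀ i, ¬ P i → v i = 0) → v ≠ 0 → ∃ l, 0 < v ⬝ᵥ ((Tᵀ * S l * T) *ᵥ v))
    (hN' : ∀ v : ι → ℝ, (∀ i, P i → v i = 0) → v ≠ 0 → ∃ l, v ⬝ᵥ ((Tᵀ * S l * T) *ᵥ v) < 0) :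
    (Matrix.det (∑ l, ((Polynomial.X : Polynomial ℝ) ^ d l) • (S l).map Polynomial.C)).roots.toFinset.filter
        (fun t => 0 < t) = ∅ := by
  rw [← posRoots_pencil_congr d S T hT]
  exact quasiDefinite_pencil_posRoots_eq_empty d (fun l => Tᵀ * S l * T) (fun l => GramDual.isSymm_conj (hS l) T) P
    hP hN hP' hN'

end Pencil

/-! ## §4  Block form -/

section Blocks

variable {a b K : ℕ}

/-- The quadratic form of `fromBlocks A X Xᵀ (−D)` on a vector supported on the left block is `v_PᵀAv_P`. [folklore] -/
theorem form_fromBlocks_inl (A : Matrix (Fin a) (Fin a) ℝ) (X : Matrix (Fin a) (Fin b) ℝ) (D : Matrix (Fin b) (Fin b) ℝ)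
    (v : Fin a ⊕ Fin b → ℝ) (hv : ∀ i, ¬ (Sum.isLeft i = true) → v i = 0) :
    v ⬝ᵥ ((Matrix.fromBlocks A X Xᵀ (-D)) *ᵥ v) = (v ∘ Sum.inl) ⬝ᵥ (A *ᵥ (v ∘ Sum.inl)) := by
  have hr : v ∘ Sum.inr = 0 := funext fun j => hv (Sum.inr j) (by simp)
  rw [Matrix.fromBlocks_mulVec, Matrix.dotProduct_block, Sum.elim_comp_inl, Sum.elim_comp_inr, hr]
  simp only [Matrix.mulVec_zero, add_zero, zero_dotProduct]

/-- The quadratic form of `fromBlocks A X Xᵀ (−D)` on a vector supported on the right block is `−v_NᵀDv_N`. [folklore] -/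
theorem form_fromBlocks_inr (A : Matrix (Fin a) (Fin a) ℝ) (X : Matrix (Fin a) (Fin b) ℝ) (D : Matrix (Fin b) (Fin b) ℝ)
    (v : Fin a ⊕ Fin b → ℝ) (hv : ∀ i, Sum.isLeft i = true → v i = 0) :
    v ⬝ᵥ ((Matrix.fromBlocks A X Xᵀ (-D)) *ᵥ v) = -((v ∘ Sum.inr) ⬝ᵥ (D *ᵥ (v ∘ Sum.inr))) := by
  have hl : v ∘ Sum.inl = 0 := funext fun i => hv (Sum.inl i) (by simp)
  rw [Matrix.fromBlocks_mulVec, Matrix.dotProduct_block, Sum.elim_comp_inl, Sum.elim_comp_inr, hl]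
  simp only [Matrix.mulVec_zero, zero_add, zero_dotProduct, Matrix.neg_mulVec, dotProduct_neg]

/-- **BLOCK FORM OF THE CONE LAW.**  Letters `S_l = [[A_l, X_l], [X_lᵀ, −D_l]]` with `A_l, D_l ⪰ 0`, `Σ_l A_l ≻ 0`,
`Σ_l D_l ≻ 0` and ARBITRARY `X_l`: `det(Σ_l X^{d_l} S_l)` has no positive zero (any block sizes, any `K`, all exponents).
[folklore] -/
theorem fromBlocks_pencil_posRoots_eq_empty (d : Fin K → ℕ) (A : Fin K → Matrix (Fin a) (Fin a) ℝ)
    (X : Fin K → Matrix (Fin a) (Fin b) ℝ) (D : Fin K → Matrix (Fin b) (Fin b) ℝ)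
    (hA : ∀ l, (A l).PosSemidef) (hD : ∀ l, (D l).PosSemidef) (hA' : (∑ l, A l).PosDef) (hD' : (∑ l, D l).PosDef) :
    (Matrix.det (∑ l, ((Polynomial.X : Polynomial ℝ) ^ d l) •
        (Matrix.fromBlocks (A l) (X l) (X l)ᵀ (-(D l))).map Polynomial.C)).roots.toFinset.filter (fun t => 0 < t)
      = ∅ := by
  classical
  have hS : ∀ l, (Matrix.fromBlocks (A l) (X l) (X l)ᵀ (-(D l))).IsSymm := fun l =>
    Matrix.IsSymm.fromBlocks (GramDual.isSymm_of_isHermitian_real (hA l).1) rfl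
      (GramDual.isSymm_of_isHermitian_real (hD l).1).neg
  refine quasiDefinite_pencil_posRoots_eq_empty d _ hS (fun i => Sum.isLeft i = true) (fun l v hv => ?_)
    (fun l v hv => ?_) (fun v hv hv0 => ?_) (fun v hv hv0 => ?_)
  · rw [form_fromBlocks_inl _ _ _ v hv]
    simpa only [star_trivial] using (hA l).dotProduct_mulVec_nonneg (v ∘ Sum.inl)
  · rw [form_fromBlocks_inr _ _ _ v hv, neg_nonpos]
    simpa only [star_trivial] using (hD l).dotProduct_mulVec_nonneg (v ∘ Sum.inr)
  · -- strictness on the left block from `Σ A_l ≻ 0`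
    have hw0 : v ∘ Sum.inl ≠ 0 := by
      intro h
      apply hv0
      funext i
      cases i with
      | inl i => exact congrFun h i
      | inr j => exact hv (Sum.inr j) (by simp)
    have hpos : (0 : ℝ) < ∑ l, (v ∘ Sum.inl) ⬝ᵥ (A l *ᵥ (v ∘ Sum.inl)) := by
      have h := hA'.dotProduct_mulVec_pos hw0
      rwa [star_trivial, Matrix.sum_mulVec, dotProduct_sum] at h
    obtain ⟨l, -, hl⟩ := Finset.exists_lt_of_sum_lt (s := (Finset.univ : Finset (Fin K))) (f := fun _ => (0 : ℝ))
      (g := fun l => (v ∘ Sum.inl) ⬝ᵥ (A l *ᵥ (v ∘ Sum.inl))) (by rwa [Finset.sum_const_zero])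
    exact ⟨l, by rw [form_fromBlocks_inl _ _ _ v hv]; exact hl⟩
  · -- strictness on the right block from `Σ D_l ≻ 0`
    have hw0 : v ∘ Sum.inr ≠ 0 := by
      intro h
      apply hv0
      funext i
      cases i with
      | inl i => exact hv (Sum.inl i) (by simp)
      | inr j => exact congrFun h j
    have hpos : (0 : ℝ) < ∑ l, (v ∘ Sum.inr) ⬝ᵥ (D l *ᵥ (v ∘ Sum.inr)) := by
      have h := hD'.dotProduct_mulVec_pos hw0
      rwa [star_trivial, Matrix.sum_mulVec, dotProduct_sum] at h
    obtain ⟨l, -, hl⟩ := Finset.exists_lt_of_sum_lt (s := (Finset.univ : Finset (Fin K))) (f := fun _ => (0 : ℝ))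
      (g := fun l => (v ∘ Sum.inr) ⬝ᵥ (D l *ᵥ (v ∘ Sum.inr))) (by rwa [Finset.sum_const_zero])
    exact ⟨l, by rw [form_fromBlocks_inr _ _ _ v hv, neg_neg_iff_pos]; exact hl⟩

end Blocks

end QuasiDefinite

end Summit.ValiantsHypothesis.ValiantsHypothesis.Theorems.LacunarySymmetroidMatrixDescartes
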